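import Mathlib.Analysis.InnerProductSpace.PiL2
import Mathlib.Analysis.Calculus.IteratedDeriv.Defs
import Mathlib.MeasureTheory.Measure.Haar.InnerProductSpace
import Literature.Analysis.FluidPDE.MildSolution
import Literature.Analysis.UnboundedOperators.HeatKernel
import Literature.Analysis.FluidPDE.VectorCalculus
import HarnessLib

/-!
# Time analyticity of bounded mild solutions of Navier–Stokes (Dong–Zhang 2020)
(topic `Literature/Analysis/FluidPDE`)

A NAMED FACT (theorem in print, `def … : Prop`, D-0014) wanted by route `ClockStretchingLaw` of
`NavierStokesRegularity` (item `SteadySliceLiouville` = `stmt-NavierStokesRegularity-10218`: "time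
analyticity of bounded mild solutions (DongZhang2020 Thm 2 = arXiv:1907.01687, radius depending only
on the `L^∞` bound) propagates `u(t) = u(t₀)` to all `t < 0`"; the planner: "May take a named
DongZhang2020 fact as hypothesis if the grounder so rules"). Users take
`(h : DongZhang2020_timeDerivative_bounds_boundedMild)`. Re-proposal after reviews p53631 (mild
solution now in the paper's kernel sense) and p54385 (divergence-free slices explicit); see Rendering.

* FACT `DongZhang2020_timeDerivative_bounds_boundedMild` — Dong–Zhang, *Time analyticity for the
  heat equation and Navier–Stokes equations*, J. Funct. Anal. 279 (2020) 108563 = arXiv:1907.01687,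
  §3 Theorem 2 (Theorem 3.1 of the journal version), READ from the held arXiv text (p. 7 of the
  text files): "Assume that `u` is a mild solution to the incompressible Navier–Stokes equations
  `u_t − Δu + u·∇u + ∇p = 0` on `[0,1] × ℝᵈ` and `|u| ≤ C₂` in `[0,1] × ℝᵈ`. Then for any `n ≥ 1`,
  `sup_{t ∈ (0,1]} tⁿ ‖∂ₜⁿ u(t,·)‖_{L∞(ℝᵈ)} ≤ N^{n+1} nⁿ` for some sufficiently large constant
  `N ≥ 1`. Consequently, `u(t,x)` is analytic in time for any `t ∈ (0,1]`."

## Rendering (every deviation below is either the printed hypothesis made explicit or a WEAKENING)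

* `ℝᵈ` is `EuclideanSpace ℝ (Fin d)`, `d ≥ 2`, viscosity `ν = 1`, no force. "MILD SOLUTION" IS TAKEN IN THE
  PAPER'S SENSE (p. 7, proof: `u = E * u(0) − ∫₀ᵗ E(t−s) * ∇·(u ⊗ u) ds` with the Oseen/Stokes kernel
  `E`), rendered with the tree's heat semigroup `heatFlow` (`MildSolution.lean`) and Oseen–Koch–Tataru
  kernel `oseenKernel` (`KochTataru.lean`, the kernel of `e^{τΔ} Π ∇·`): for all `0 ≤ s < t ≤ 1` and
  all `x`, `u(t,x) = (e^{(t−s)Δ} u(s))(x) − ∫_{(s,t)} ∫ K(t−τ, x−y)[u(τ,y), u(τ,y)] dy dτ` (the two-time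
  form; the paper's one-time form from `s = 0` is the case `s = 0`, and for bounded solutions the two
  are equivalent by the semigroup property — asking all `s` is a harmless strengthening of the
  hypothesis, i.e. a weakening of the fact). This is also literally the "KNSS-mild" identity of the
  consuming route. NOT the tree's duality-form `IsMildNSSolutionOn` (tested against divergence-free
  fields only), which does not determine a bounded field modulo `a(t)∇h`, `h` harmonic — Serrin's
  example `u = a(t)∇h`, cited on p. 7 of the paper as a NON-mild, non-time-analytic solution, satisfies
  the duality form (review of p53631); the kernel form excludes it (`∫ K(τ,z)[c,c] dz = 0`, so the
  identity forces `a` constant).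
* INCOMPRESSIBILITY, explicit (review of p54385): the printed theorem is about the INCOMPRESSIBLE
  Navier–Stokes equations, with the Leray projection inside the Stokes–Oseen kernel `E = PΓ` acting on
  the datum; the kernel identity above uses the plain heat semigroup on `u(s)` and by itself only gives
  `div u(t) = e^{(t−s)Δ} div u(s)` (the Picard solution from small bounded NON-solenoidal data satisfies
  it), so the slices are required to be divergence free: `VectorCalculus.IsDivFree (u t)` for
  `t ∈ (0,1)` (pointwise `tr Du(t,x) = 0`, meaningful on the open slab where `u` is smooth). For such
  `u` the two formulations agree (`E * u(s) = e^{(t−s)Δ} u(s)` when `div u(s) = 0`), so the fact is the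
  printed theorem restricted to smooth representatives. The consuming route's class is divergence
  free.
* `u` jointly Borel measurable (so that the Bochner integrals are the genuine absolutely convergent
  ones: `|K(τ,z)[a,b]| ≲ (√τ + |z|)^{-d-1}|a||b|`, Koch–Tataru (14)).
* Boundedness `|u| ≤ C₂` on `[0,1] × ℝᵈ` pointwise, as printed.
* EXTRA HYPOTHESIS (weakening): `u` is smooth on the open slab `(0,1) × ℝᵈ`
  (`ContDiffOn ℝ (⊤ : ℕ∞) (uncurry u) (Ioo 0 1 ×ˢ univ)`, i.e. `C^∞`, NOT `C^ω`), so that the pointwise iterated time derivatives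
  in the conclusion are the genuine ones of the given representative (bounded mild solutions are
  smooth for `t > 0`; the duality-form class fixes `u` only slice-wise a.e., whence the explicit
  hypothesis). The route's consumers (smooth KNSS-mild ancient solutions) have it.
* Conclusion on the OPEN interval `t ∈ (0,1)` (the printed `(0,1]` includes the endpoint, where a
  two-sided `iteratedDeriv` of a function given on `[0,1]` would read junk values beyond `t = 1`):
  `∃ N ≥ 1, ∀ n ≥ 1, ∀ t ∈ (0,1), ∀ x, tⁿ ‖∂ₜⁿ u(t,x)‖ ≤ N^{n+1} nⁿ` with Mathlib's
  `iteratedDeriv n (fun s => u s x) t`. The factorial-type bound `N^{n+1} nⁿ ≤ N^{n+1} eⁿ n!` is what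
  gives a radius of time-analyticity `≥ t/(Ne)` at time `t`; the analyticity corollary itself is not
  restated (Mathlib's `AnalyticAt` for Banach-valued curves would need the slice as an element of a
  function space; consumers use the derivative bounds + Taylor's theorem directly).

* The printed constant `N` depends only on `d` and `‖u‖_{L∞}` (p. 7); here `∃ N` after fixing
  `(d, u, C₂)` — a harmless weakening, recorded.

Mathlib / tree: `heatFlow` (`MildSolution.lean`), `UnboundedOperators.heatKernel` (`HeatKernel.lean`;
the unfolded `oseenKernel` of `KochTataru.lean`); `iteratedDeriv`,
`ContDiffOn` (Mathlib). No time-analyticity statement for Navier–Stokes or the heat equation exists in the tree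
(`lean search 'timeAnalytic|DongZhang|analytic in time'` → nothing).

## References

* H. Dong, Q. S. Zhang, *Time analyticity for the heat equation and Navier–Stokes equations*,
  J. Funct. Anal. 279 (2020), no. 4, 108563; arXiv:1907.01687, §3 Theorem 2. [DongZhang2020]
-/

noncomputable section

open MeasureTheory Set Function

namespace Literature.Analysis.FluidPDE

/-- **Dong–Zhang 2020, Theorem 2 of §3 (time-derivative bounds ⇒ time analyticity of bounded mild
solutions).** Let `d ≥ 2` and let `u` be a bounded (`‖u(t,x)‖ ≤ C₂` on `[0,1] × ℝᵈ`), jointly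
measurable, divergence-free (slices on `(0,1)`) mild solution of the incompressible Navier–Stokes
equations (viscosity `1`, no force) on `[0,1] × ℝᵈ` in the paper's Oseen-kernel sense, `u(t) = e^{(t−s)Δ}u(s) − ∫ₛᵗ e^{(t−τ)Δ}Π∇·(u⊗u)(τ) dτ`
pointwise for all `0 ≤ s < t ≤ 1` (tree: `heatFlow`, and the `oseenKernel` of `KochTataru.lean` in its
unfolded closed Gaussian form), and (harmless extra hypothesis,
see the module docstring) smooth on `(0,1) × ℝᵈ`. Then there is `N ≥ 1` such that for
every `n ≥ 1`, every `t ∈ (0,1)` and every `x`, `tⁿ ‖∂ₜⁿ u(t,x)‖ ≤ N^{n+1} nⁿ`. (Printed with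
`sup_{t ∈ (0,1]}` of the `L^∞` norm; "Consequently, `u(t,x)` is analytic in time for any
`t ∈ (0,1]`".) Grounds
`Summit.NavierStokesRegularity.NavierStokesRegularity.Theses.ClockStretchingLaw.SteadySliceLiouville`.
[cite: DongZhang2020, §3 Thm 2] -/
def DongZhang2020_timeDerivative_bounds_boundedMild : Prop :=
  ∀ (d : ℕ) (u : ℝ → EuclideanSpace ℝ (Fin d) → EuclideanSpace ℝ (Fin d)) (C₂ : ℝ), 2 ≤ d →
    Measurable (uncurry u) →
    (∀ t ∈ Ioo (0 : ℝ) 1, VectorCalculus.IsDivFree (u t)) →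
    (∀ t ∈ Icc (0 : ℝ) 1, ∀ x, ‖u t x‖ ≤ C₂) →
    (∀ s t : ℝ, 0 ≤ s → s < t → t ≤ 1 → ∀ x,
      u t x = heatFlow (u s) (t - s) x -
        ∫ τ in Ioo s t, ∫ y,
          ((-(inner ℝ (x - y) (u τ y) / (2 * (t - τ)) *
                UnboundedOperators.heatKernel (t - τ) (x - y))) • u τ y +
            (∫ σ in Ioi (t - τ), UnboundedOperators.heatKernel σ (x - y) / (4 * σ ^ 2)) •
              (inner ℝ (x - y) (u τ y) • u τ y + inner ℝ (u τ y) (u τ y) • (x - y) +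
                inner ℝ (x - y) (u τ y) • u τ y) -
            ((∫ σ in Ioi (t - τ), UnboundedOperators.heatKernel σ (x - y) / (8 * σ ^ 3)) *
                (inner ℝ (x - y) (u τ y) * inner ℝ (x - y) (u τ y))) • (x - y))) →
    ContDiffOn ℝ (⊤ : ℕ∞) (uncurry u) (Ioo (0 : ℝ) 1 ×ˢ univ) →
    ∃ N : ℝ, 1 ≤ N ∧ ∀ n : ℕ, 1 ≤ n → ∀ t ∈ Ioo (0 : ℝ) 1, ∀ x : EuclideanSpace ℝ (Fin d),
      t ^ n * ‖iteratedDeriv n (fun s : ℝ => u s x) t‖ ≤ N ^ (n + 1) * (n : ℝ) ^ n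

end Literature.Analysis.FluidPDE

end
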